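import Mathlib
import Literature.MathematicalPhysics.QuantumFieldTheory.Balaban1983to89.B5Prop11Bound
import Literature.MathematicalPhysics.QuantumFieldTheory.Balaban1983to89.B5Prop11Leaves

/-!
# B5, Proposition 1.1 / (1.89): Bałaban's own functions instantiate the abstract fiber of
`B5Prop11Bound` — the dictionary residual discharged in the kernel

Source under audit (cell `pub-balaban`, node T02.1, SHARPEN pass 3; value = kernel-checked
discharge of a dictionary residual, NOT summit progress):
T. Bałaban, *Propagators and renormalization transformations for lattice gauge theories. I*,
Commun. Math. Phys. **95** (1984) 17–40 (`Balaban1984PropagatorsI`, "B5"). Page numbers are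
journal pages; quotations are read off the rendered PDF (cell folder
`b2b-balaban-ref1/pages/1984-cmp95-propagators-rt-I/`, PDF page = journal page − 16).

## What the paper prints (verbatim)

* p. 23, (1.31) and the sentence after it:
  "Δ(p) = Σ_{μ=1}^{d} |∂_μ(p)|²,  ∂_μ(p) = (e^{iηp_μ} − 1)/η,
   u_k(p) = Π_{μ=1}^{d} (e^{ip′_μ} − 1)/((e^{iηp_μ} − 1)/η) = Π_{μ=1}^{d} ∂¹_μ(p′)/∂_μ(p),   (1.31)
   where p′ belongs to a dual torus T̃₁^{(k)} = {p′ = (p′₁, …, p′_d): p′_μ = (π/L_μ)L^kε n_μ,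
   n_μ is an integer, −L_μ/L^kε ≤ n_μ < L_μ/L^kε, μ = 1, …, d},  p ∈ T̃_η is represented as a
   sum p = p′ + l, p′ ∈ T̃₁^{(k)} and l = (l₁, …, l_d), l_μ = 2πm_μ, m_μ is an integer,
   −(L^k − 1)/2 ≤ m_μ ≤ (L^k − 1)/2 for L odd, −L^k/2 ≤ m_μ < L^k/2 for L even."
  and, p. 23: "Because u_k(l) = 0 for l ≠ 0, u_k(0) = 1, …".
* p. 28, (1.61)–(1.62): "(Q_kA)~_μ(p′) = Σ_l u(p′+l)v_μ(p′+l)Ã_μ(p′+l),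
  v_μ(p) = ∂¹_μ(p′)/∂_μ(p),   (1.61)  …  φ_μ(p′) = Σ_l |u(p′+l)|²|v_μ(p′+l)|²/Δ(p′+l),   (1.62)
  where we have omitted the subscript k. Multiplying φ_μ(p′) by Δ₀(p′), we get a well-defined
  positive function for all p′ ∈ T̃₁^{(k)}, 0 < γ₀ ≤ Δ₀(p′)φ_μ(p′) ≤ γ₁."
* p. 33, Proposition 1.1 (quoted in full in `B5Prop11Bound`): "… ≤ γ₀⁻¹‖J‖, (1.89) with a
  positive constant γ₀ independent of k, T_η, and depending on d only (if we put a = 1)."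

## What is certified here (kernel; 0 sorry; no axioms beyond Mathlib's)

With `η = L^{−k} = 1/n` (so that `∂_μ(p′+l) = n(e^{i(p′_μ+l_μ)/n} − 1)`), real `p′ = s` in the
Brillouin zone `|s_μ| ≤ π`, `s ≠ 0`, and the offsets `l_μ = 2πk_μ` represented by
`k : Fin d → Fin n` exactly as in the tree modules `B4Strip` / `B5Prop11Leaves` (all the
functions are `2πn`-periodic in `l_μ`, so the choice of representatives is immaterial):

* `dSym n k s μ` = `∂_μ(p′+l)`, `d1Sym s μ` = `∂¹_μ(p′)` (= `∂_{1,μ}(p′)` of (1.83)),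
  `vSym` = `v_μ(p′+l) = ∂¹_μ(p′)/∂_μ(p′+l)` of (1.61) with the removable singularity at
  `p′_μ = l_μ = 0` filled by its limit value `1` (consistent with the printed "u_k(0) = 1"),
  `uSym` = `u(p′+l) = Π_μ v_μ(p′+l)` of (1.31).
* the identities `‖∂_μ(p′+l)‖² = S_ξ(p′_μ+l_μ)`, `Δ(p′+l) = DeltaXir n 0 (shiftr n k s)`,
  `‖∂¹_μ(p′)‖² = S₁(p′_μ)`, `Δ₀(p′) = Delta1r 0 s`, `‖v_μ(p′+l)‖² = uFactorr n k_μ s_μ`,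
  `‖u(p′+l)‖² = Ur n k s` — i.e. these complex functions have EXACTLY the squared moduli that
  `B4Strip` / `B5Prop11Leaves` reason about (`norm_vSym_sq`, `norm_uSym_sq`), and
  `∂_μ(p′+l) = 0 ⟺ p′_μ = 0 ∧ k_μ = 0` (`dSym_eq_zero_iff`).
* `balabanFiber` : a term of type `B5Prop11Bound.Fiber (Fin d → Fin n) d` whose data are the
  functions above (`o` = the offset `0`, `Δ k = DeltaXir n 0 (shiftr n k s)`, constants
  `c_u = (4/π²)^d`, `c_uv = (4/π²)^{d+1}`, `κ = π²/4`) and whose twelve Prop fields E1–E4 are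
  ALL PROVED here from the tree lemmas `B5Prop11Leaves.S1r_le_Sxir_shift`,
  `.DeltaXir_shift_ge_four`, `.Delta1r_le_DeltaXir_shift`, `.DeltaXir_le_Delta1r`,
  `.Delta1r_pos`, `.S0_le_one`, `B4Strip.Sxir_pos`, `.uFactorr_zero_ge`, `.Ur_zero_ge` — for
  EVERY `d`, every `n = L^k ≥ 1`, every `a > 0`, every `p′ ≠ 0` in the zone.
* hence (`opNorm_sandwich_G_le`, `opNorm_G_le`, `opNorm_sandwich_G_le_of_orders` and the six
  named instances `opNorm_D_G_le`, …): the fiber matrices of (1.83) for Bałaban's functions,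
  sandwiched between diagonal weights made of the derivative symbols `∂_ν(p′+l)` of total
  order ≤ 2, have `ℓ² → ℓ²` operator norm at most
  `gamma0 d a := gamma0inv d a ((4/π²)^d) ((4/π²)^{d+1}) (π²/4)` — a constant depending on
  `d` and `a` ONLY, uniformly in `p′`, `k` (i.e. `n`) and the torus: the printed
  "depending on d only (if we put a = 1)", with an explicit (OUR) constant.

## What is NOT certified here (unchanged from `B5Prop11Bound`, items (1), (3), (4))

The Plancherel identification of the six `L²(T_η)` operator norms of (1.89) with suprema over
`p′` of norms of such sandwiches (and the bookkeeping of the coordinate maps), the zero fiber's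
place in that supremum (it is bounded separately by `B5Prop11Bound.opNorm_sandwich_G₀_le`),
and (1.90) are not formalised; no value of `γ₀` is attributed to the paper.
-/

open scoped BigOperators Matrix ComplexConjugate Matrix.Norms.L2Operator
open Finset Complex

namespace Literature.MathematicalPhysics.QuantumFieldTheory.Balaban1983to89.B5Prop11Fiber

open Literature.MathematicalPhysics.QuantumFieldTheory.Balaban1983to89.B4Strip
open Literature.MathematicalPhysics.QuantumFieldTheory.Balaban1983to89.B5Prop11Leaves
open Literature.MathematicalPhysics.QuantumFieldTheory.Balaban1983to89.B5Prop11Bound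

noncomputable section

variable {d : ℕ}

/-! ## A. The printed functions at the fiber `p′ = s`, offset `l = 2πk` -/

/-- `∂_μ(p′ + l) = (e^{iη(p′_μ + l_μ)} − 1)/η` with `η = 1/n`, `l_μ = 2πk_μ`.
[cite: Balaban1984PropagatorsI, (1.31) p.23] -/
def dSym (n : ℕ) (k : Fin d → Fin n) (s : Fin d → ℝ) (μ : Fin d) : ℂ :=
  (n : ℂ) * (Complex.exp (((shiftr n k s μ / n : ℝ) : ℂ) * I) - 1)

/-- `∂¹_μ(p′) = e^{ip′_μ} − 1` (the unit-lattice derivative symbol; `∂_{1,μ}(p′)` in (1.83)).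
[cite: Balaban1984PropagatorsI, (1.31) p.23] -/
def d1Sym (s : Fin d → ℝ) (μ : Fin d) : ℂ := Complex.exp (((s μ : ℝ) : ℂ) * I) - 1

/-- `v_μ(p) = ∂¹_μ(p′)/∂_μ(p)`, `p = p′ + l`, with the value `1` where `∂_μ(p′+l) = 0`
(i.e. at `p′_μ = l_μ = 0`, where also `∂¹_μ(p′) = 0`; the continuous extension).
[cite: Balaban1984PropagatorsI, (1.61) p.28] -/
def vSym (n : ℕ) (k : Fin d → Fin n) (s : Fin d → ℝ) (μ : Fin d) : ℂ :=
  if dSym n k s μ = 0 then 1 else d1Sym s μ / dSym n k s μ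

/-- `u(p) = Π_μ ∂¹_μ(p′)/∂_μ(p) = Π_μ v_μ(p)`. [cite: Balaban1984PropagatorsI, (1.31) p.23] -/
def uSym (n : ℕ) (k : Fin d → Fin n) (s : Fin d → ℝ) : ℂ := ∏ μ, vSym n k s μ

/-! ## B. Squared moduli = the real functions of `B4Strip` / `B5Prop11Leaves` -/

/-- `|e^{it} − 1|² = S₁(t)`. [folklore] -/
theorem norm_exp_mul_I_sub_one_sq (t : ℝ) : ‖Complex.exp ((t : ℂ) * I) - 1‖ ^ 2 = S1r t := by
  rw [← Complex.normSq_eq_norm_sq]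
  exact normSq_exp_sub_one t

/-- `S_ξ(x) = n² S₁(x/n)`. [folklore] -/
theorem Sxir_eq_sq_mul_S1r (n : ℕ) (x : ℝ) : Sxir n x = (n : ℝ) ^ 2 * S1r (x / n) := by
  unfold Sxir S1r
  ring

/-- `|∂_μ(p′+l)|² = S_ξ(p′_μ + l_μ)`. [folklore] -/
theorem norm_dSym_sq (n : ℕ) (k : Fin d → Fin n) (s : Fin d → ℝ) (μ : Fin d) :
    ‖dSym n k s μ‖ ^ 2 = Sxir n (shiftr n k s μ) := by
  unfold dSym
  rw [norm_mul, mul_pow, Complex.norm_natCast, norm_exp_mul_I_sub_one_sq, Sxir_eq_sq_mul_S1r]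

/-- `|∂¹_μ(p′)|² = S₁(p′_μ)`. [folklore] -/
theorem norm_d1Sym_sq (s : Fin d → ℝ) (μ : Fin d) : ‖d1Sym s μ‖ ^ 2 = S1r (s μ) :=
  norm_exp_mul_I_sub_one_sq _

/-- `Δ(p′+l) = Σ_μ |∂_μ(p′+l)|²` is `DeltaXir n 0 (shiftr n k s)`. [folklore] -/
theorem Delta_eq (n : ℕ) (k : Fin d → Fin n) (s : Fin d → ℝ) :
    DeltaXir n 0 (shiftr n k s) = ∑ μ, ‖dSym n k s μ‖ ^ 2 := by
  unfold DeltaXir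
  simp only [add_zero, norm_dSym_sq]

/-- `Δ₀(p′) = Σ_μ |∂¹_μ(p′)|²` is `Delta1r 0 s`. [folklore] -/
theorem Delta0_eq (s : Fin d → ℝ) : Delta1r 0 s = ∑ μ, ‖d1Sym s μ‖ ^ 2 := by
  unfold Delta1r
  simp only [add_zero, norm_d1Sym_sq]

/-- `|∂¹_μ(p′)|² ≤ |∂_μ(p′+l)|²` for every `l`. [folklore] -/
theorem norm_d1Sym_sq_le (n : ℕ) (hn : 1 ≤ n) (k : Fin d → Fin n) (s : Fin d → ℝ) (μ : Fin d) :
    ‖d1Sym s μ‖ ^ 2 ≤ ‖dSym n k s μ‖ ^ 2 := by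
  rw [norm_d1Sym_sq, norm_dSym_sq]
  exact S1r_le_Sxir_shift n hn (s μ) (k μ : ℕ)

/-- `|∂¹_μ(p′)| ≤ |∂_μ(p′+l)|`. [folklore] -/
theorem norm_d1Sym_le (n : ℕ) (hn : 1 ≤ n) (k : Fin d → Fin n) (s : Fin d → ℝ) (μ : Fin d) :
    ‖d1Sym s μ‖ ≤ ‖dSym n k s μ‖ :=
  (pow_le_pow_iff_left₀ (norm_nonneg _) (norm_nonneg _) two_ne_zero).mp
    (norm_d1Sym_sq_le n hn k s μ)

/-- where `∂_μ(p′+l)` vanishes, so does `∂¹_μ(p′)`. [folklore] -/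
theorem d1Sym_eq_zero_of (n : ℕ) (hn : 1 ≤ n) (k : Fin d → Fin n) (s : Fin d → ℝ) (μ : Fin d)
    (h : dSym n k s μ = 0) : d1Sym s μ = 0 := by
  have h1 := norm_d1Sym_le n hn k s μ
  rw [h, norm_zero] at h1
  exact norm_le_zero_iff.mp h1

/-- E1: `∂¹_μ(p′) = v_μ(p′+l) ∂_μ(p′+l)` (the definition (1.61), including the degenerate
point). [folklore] -/
theorem d1Sym_eq_vSym_mul (n : ℕ) (hn : 1 ≤ n) (k : Fin d → Fin n) (s : Fin d → ℝ) (μ : Fin d) :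
    d1Sym s μ = vSym n k s μ * dSym n k s μ := by
  unfold vSym
  split_ifs with h
  · rw [h, mul_zero]
    exact d1Sym_eq_zero_of n hn k s μ h
  · rw [div_mul_cancel₀ _ h]

/-- E3: `|v_μ(p′+l)| ≤ 1`. [folklore] -/
theorem norm_vSym_le_one (n : ℕ) (hn : 1 ≤ n) (k : Fin d → Fin n) (s : Fin d → ℝ) (μ : Fin d) :
    ‖vSym n k s μ‖ ≤ 1 := by
  unfold vSym
  split_ifs with h
  · simp
  · rw [norm_div, div_le_one (norm_pos_iff.mpr h)]
    exact norm_d1Sym_le n hn k s μ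

/-- E3: `|u(p′+l)| ≤ 1`. [folklore] -/
theorem norm_uSym_le_one (n : ℕ) (hn : 1 ≤ n) (k : Fin d → Fin n) (s : Fin d → ℝ) :
    ‖uSym n k s‖ ≤ 1 := by
  unfold uSym
  rw [norm_prod]
  exact Finset.prod_le_one (fun _ _ => norm_nonneg _) (fun μ _ => norm_vSym_le_one n hn k s μ)

/-- E1: `|∂¹_μ(p′)| ≤ 2`. [folklore] -/
theorem norm_d1Sym_le_two (s : Fin d → ℝ) (μ : Fin d) : ‖d1Sym s μ‖ ≤ 2 := by
  unfold d1Sym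
  calc ‖Complex.exp (((s μ : ℝ) : ℂ) * I) - 1‖
      ≤ ‖Complex.exp (((s μ : ℝ) : ℂ) * I)‖ + ‖(1 : ℂ)‖ := norm_sub_le _ _
    _ = 2 := by rw [Complex.norm_exp_ofReal_mul_I, norm_one]; norm_num

/-- `∂_μ(p′+l) = 0` exactly at `p′_μ = 0`, `l_μ = 0` (on the zone `|p′_μ| ≤ π`). [folklore] -/
theorem dSym_eq_zero_iff (n : ℕ) [NeZero n] (hn : 1 ≤ n) (k : Fin d → Fin n) (s : Fin d → ℝ)
    (μ : Fin d) (hs : |s μ| ≤ Real.pi) : dSym n k s μ = 0 ↔ s μ = 0 ∧ k μ = 0 := by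
  constructor
  · intro h
    have h0 : Sxir n (shiftr n k s μ) = 0 := by
      rw [← norm_dSym_sq, h, norm_zero]
      norm_num
    have hsh : shiftr n k s μ = s μ + 2 * Real.pi * ((k μ : ℕ) : ℝ) := rfl
    by_cases hk : k μ = 0
    · refine ⟨?_, hk⟩
      by_contra hsμ
      have hpos := Sxir_pos n hn (s μ) hsμ hs
      rw [hsh, hk] at h0
      simp only [Fin.val_zero, Nat.cast_zero, mul_zero, add_zero] at h0
      linarith
    · exfalso
      have hk1 : 1 ≤ (k μ : ℕ) := Nat.one_le_iff_ne_zero.mpr (fun h' => hk (Fin.ext h'))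
      have hk2 : (k μ : ℕ) + 1 ≤ n := (k μ).isLt
      have h4 := Sxir_shift_ge_four n (k μ : ℕ) hk1 hk2 (s μ) hs
      rw [hsh] at h0
      linarith
  · rintro ⟨h1, h2⟩
    unfold dSym
    have : shiftr n k s μ = 0 := by
      show s μ + 2 * Real.pi * ((k μ : ℕ) : ℝ) = 0
      rw [h1, h2]
      simp
    rw [this]
    simp

/-- `|v_μ(p′+l)|² = uFactorr n k_μ p′_μ` — the complex `v_μ` of (1.61) has exactly the squared
modulus `B4Strip.uFactorr` (all cases of the removable singularity included). [folklore] -/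
theorem norm_vSym_sq (n : ℕ) [NeZero n] (hn : 1 ≤ n) (k : Fin d → Fin n) (s : Fin d → ℝ)
    (μ : Fin d) (hs : |s μ| ≤ Real.pi) : ‖vSym n k s μ‖ ^ 2 = uFactorr n (k μ : ℕ) (s μ) := by
  have hsh : shiftr n k s μ = s μ + 2 * Real.pi * ((k μ : ℕ) : ℝ) := rfl
  unfold vSym uFactorr
  by_cases h : dSym n k s μ = 0
  · obtain ⟨h1, h2⟩ := (dSym_eq_zero_iff n hn k s μ hs).mp h
    have h2' : (k μ : ℕ) = 0 := by rw [h2]; exact Fin.val_zero n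
    simp [h, h1, h2']
  · rw [if_neg h, norm_div, div_pow, norm_d1Sym_sq, norm_dSym_sq, hsh]
    have hne : ¬ (s μ = 0 ∧ k μ = 0) := fun h' => h ((dSym_eq_zero_iff n hn k s μ hs).mpr h')
    by_cases hk : (k μ : ℕ) = 0
    · have hkμ : k μ = 0 := Fin.ext (by rw [hk]; exact (Fin.val_zero n).symm)
      have hsμ : ¬ s μ = 0 := fun h' => hne ⟨h', hkμ⟩
      rw [if_pos hk, if_neg hsμ, hk]
      simp
    · rw [if_neg hk]

/-- `|u(p′+l)|² = Ur n k p′` — the complex `u` of (1.31) has exactly the squared modulus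
`B4Strip.Ur` (= the printed `|u_j(p′+l)|²`). [folklore] -/
theorem norm_uSym_sq (n : ℕ) [NeZero n] (hn : 1 ≤ n) (k : Fin d → Fin n) (s : Fin d → ℝ)
    (hs : ∀ μ, |s μ| ≤ Real.pi) : ‖uSym n k s‖ ^ 2 = Ur n k s := by
  unfold uSym Ur
  rw [norm_prod, ← Finset.prod_pow]
  exact Finset.prod_congr rfl fun μ _ => norm_vSym_sq n hn k s μ (hs μ)

/-! ## C. The fiber of (1.83) for Bałaban's functions -/

/-- Bałaban's fiber at `p′ = s ≠ 0` (`|s_μ| ≤ π`), `η = 1/n`, parameter `a > 0`: the data of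
(1.83) are the printed functions (1.31)/(1.61) and ALL the hypotheses E1–E4 of
`B5Prop11Bound.Fiber` are discharged by the tree lemmas of `B4Strip` / `B5Prop11Leaves`
(constants `c_u = (4/π²)^d`, `c_uv = (4/π²)^{d+1}`, `κ = π²/4`). The packaging is ours.
[cite: Balaban1984PropagatorsI, (1.31) p.23, (1.61) p.28, (1.83) p.31 (packaging ours)] -/
def balabanFiber (n : ℕ) [NeZero n] (hn : 1 ≤ n) (a : ℝ) (ha : 0 < a) (s : Fin d → ℝ)
    (hs : ∀ μ, |s μ| ≤ Real.pi) (hs0 : s ≠ 0) : Fiber (Fin d → Fin n) d where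
  o := fun _ => 0
  a := a
  cu := (4 / Real.pi ^ 2) ^ d
  cuv := (4 / Real.pi ^ 2) ^ (d + 1)
  κ := Real.pi ^ 2 / 4
  Δ := fun k => DeltaXir n 0 (shiftr n k s)
  u := fun k => uSym n k s
  v := fun μ k => vSym n k s μ
  e := fun μ k => dSym n k s μ
  e₁ := fun μ => d1Sym s μ
  a_pos := ha
  cu_pos := by positivity
  cuv_pos := by positivity
  e₁_eq := fun μ k => d1Sym_eq_vSym_mul n hn k s μ
  norm_e_sq_le := fun μ k => by
    show ‖dSym n k s μ‖ ^ 2 ≤ DeltaXir n 0 (shiftr n k s)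
    rw [Delta_eq]
    exact Finset.single_le_sum (f := fun ν => ‖dSym n k s ν‖ ^ 2) (fun _ _ => sq_nonneg _)
      (Finset.mem_univ μ)
  norm_e₁_le := fun μ => norm_d1Sym_le_two s μ
  Δ₀_pos := by
    show 0 < ∑ μ, ‖d1Sym s μ‖ ^ 2
    rw [← Delta0_eq]
    obtain ⟨μ, hμ⟩ : ∃ μ, s μ ≠ 0 := Function.ne_iff.mp hs0
    exact Delta1r_pos s hs μ hμ
  four_le := fun k hk => DeltaXir_shift_ge_four n k hk s hs
  Δ₀_le_Δo := by
    show ∑ μ, ‖d1Sym s μ‖ ^ 2 ≤ DeltaXir n 0 (shiftr n (fun _ => 0) s)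
    rw [← Delta0_eq]
    exact Delta1r_le_DeltaXir_shift n hn (fun _ => 0) s
  Δo_le := by
    show DeltaXir n 0 (shiftr n (fun _ => 0) s) ≤ Real.pi ^ 2 / 4 * ∑ μ, ‖d1Sym s μ‖ ^ 2
    rw [← Delta0_eq, shiftr_zero]
    exact DeltaXir_le_Delta1r n s hs
  norm_v_le := fun μ k => norm_vSym_le_one n hn k s μ
  norm_u_le := fun k => norm_uSym_le_one n hn k s
  cu_le := by
    show (4 / Real.pi ^ 2) ^ d ≤ ‖uSym n (fun _ => 0) s‖ ^ 2
    rw [norm_uSym_sq n hn _ s hs]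
    exact Ur_zero_ge n hn s hs
  cuv_le := fun μ => by
    show (4 / Real.pi ^ 2) ^ (d + 1) ≤ ‖uSym n (fun _ => 0) s * vSym n (fun _ => 0) s μ‖ ^ 2
    rw [norm_mul, mul_pow, norm_uSym_sq n hn _ s hs, norm_vSym_sq n hn _ s μ (hs μ), pow_succ,
      Fin.val_zero]
    exact mul_le_mul (Ur_zero_ge n hn s hs) (uFactorr_zero_ge n hn (s μ) (hs μ)) (by positivity)
      (Ur_nonneg _ _ _)
  S₀_le := by
    show ∑ k ∈ Finset.univ.erase (fun _ => (0 : Fin n)), ‖uSym n k s‖ ^ 2 ≤ 1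
    simp_rw [norm_uSym_sq n hn _ s hs]
    exact S0_le_one n hn s hs

/-- OUR explicit constant for Bałaban's functions: `γ₀⁻¹(d, a)` at the fiber level —
`gamma0inv` of `B5Prop11Bound` at `c_u = (4/π²)^d`, `c_uv = (4/π²)^{d+1}`, `κ = π²/4`;
it depends on `d` and `a` only. [folklore] -/
def gamma0 (d : ℕ) (a : ℝ) : ℝ :=
  gamma0inv d a ((4 / Real.pi ^ 2) ^ d) ((4 / Real.pi ^ 2) ^ (d + 1)) (Real.pi ^ 2 / 4)

/-! ### The derivative symbols are admissible weights -/

section Weights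

variable (n : ℕ) (s : Fin d → ℝ)

/-- order 0: the trivial weight. [folklore] -/
theorem weight_order_zero (k : Fin d → Fin n) :
    ‖(fun _ : (Fin d → Fin n) => (1 : ℂ)) k‖ ^ 2 ≤ DeltaXir n 0 (shiftr n k s) ^ 0 := by
  simp

/-- order 1: `|∂_ν(p′+l)|² ≤ Δ(p′+l)` (and the same for `conj ∂_ν`, the symbol of `∇*_ν` up to
sign). [folklore] -/
theorem weight_order_one (ν : Fin d) (k : Fin d → Fin n) :
    ‖dSym n k s ν‖ ^ 2 ≤ DeltaXir n 0 (shiftr n k s) ^ 1 := by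
  rw [pow_one, Delta_eq]
  exact Finset.single_le_sum (f := fun μ => ‖dSym n k s μ‖ ^ 2) (fun _ _ => sq_nonneg _)
    (Finset.mem_univ ν)

/-- order 1, conjugate symbol. [folklore] -/
theorem weight_order_one_conj (ν : Fin d) (k : Fin d → Fin n) :
    ‖conj (dSym n k s ν)‖ ^ 2 ≤ DeltaXir n 0 (shiftr n k s) ^ 1 := by
  rw [Complex.norm_conj]
  exact weight_order_one n s ν k

/-- order 2: `|∂_ν(p′+l) ∂_{ν′}(p′+l)|² ≤ Δ(p′+l)²`. [folklore] -/
theorem weight_order_two (ν ν' : Fin d) (k : Fin d → Fin n) :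
    ‖dSym n k s ν * dSym n k s ν'‖ ^ 2 ≤ DeltaXir n 0 (shiftr n k s) ^ 2 := by
  rw [norm_mul, mul_pow, sq (DeltaXir n 0 _)]
  have h1 := weight_order_one n s ν k
  have h2 := weight_order_one n s ν' k
  rw [pow_one] at h1 h2
  exact mul_le_mul h1 h2 (sq_nonneg _) ((sq_nonneg _).trans h1)

/-- order 2, conjugate symbols. [folklore] -/
theorem weight_order_two_conj (ν ν' : Fin d) (k : Fin d → Fin n) :
    ‖conj (dSym n k s ν) * conj (dSym n k s ν')‖ ^ 2 ≤ DeltaXir n 0 (shiftr n k s) ^ 2 := by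
  rw [← map_mul, Complex.norm_conj]
  exact weight_order_two n s ν ν' k

end Weights

section Bounds

variable (n : ℕ) [NeZero n] (hn : 1 ≤ n) (a : ℝ) (ha : 0 < a) (s : Fin d → ℝ)
  (hs : ∀ μ, |s μ| ≤ Real.pi) (hs0 : s ≠ 0)

/-- THE BOUND for Bałaban's functions: for every `d`, `n = L^k ≥ 1`, `a > 0`, `p′ = s ≠ 0` in
the zone and all diagonal weights admissible in the sense of `B5Prop11Bound.Fiber.Wt`,
`‖D_{w₁} G(p′) D_{w₂}^*‖_{ℓ²→ℓ²} ≤ gamma0 d a` — uniform in `p′`, `k`, `T_η`; the constant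
depends on `d` and `a` only ("depending on d only (if we put a = 1)"; the paper prints no
proof and no value — the constant is ours).
[cite: Balaban1984PropagatorsI, Prop. 1.1 (1.89) p.33 (fiber form for the functions (1.31)/(1.61); proof ours)] -/
theorem opNorm_sandwich_G_le {w₁ w₂ : (Fin d → Fin n) → ℂ}
    (hw : (balabanFiber n hn a ha s hs hs0).Wt w₁ w₂) :
    ‖sandwich w₁ w₂ (balabanFiber n hn a ha s hs hs0).G‖ ≤ gamma0 d a :=
  (balabanFiber n hn a ha s hs hs0).opNorm_sandwich_G_le hw

/-- `‖G(p′)‖_{ℓ²→ℓ²} ≤ gamma0 d a` (no weights; the fiber form of `‖GJ‖ ≤ γ₀⁻¹‖J‖`).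
[cite: Balaban1984PropagatorsI, Prop. 1.1 (1.89) p.33 (fiber form; proof ours)] -/
theorem opNorm_G_le : ‖(balabanFiber n hn a ha s hs hs0).G‖ ≤ gamma0 d a :=
  (balabanFiber n hn a ha s hs hs0).opNorm_G_le

/-- weights of derivative orders `j₁ + j₂ ≤ 2`: `|w₁(l)|² ≤ Δ(p′+l)^{j₁}`, `|w₂(l)|² ≤ Δ(p′+l)^{j₂}`
give `‖D_{w₁} G(p′) D_{w₂}^*‖ ≤ gamma0 d a`.
[cite: Balaban1984PropagatorsI, Prop. 1.1 (1.89) p.33 (fiber form; proof ours)] -/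
theorem opNorm_sandwich_G_le_of_orders {w₁ w₂ : (Fin d → Fin n) → ℂ} {j₁ j₂ : ℕ}
    (hj : j₁ + j₂ ≤ 2) (h₁ : ∀ k, ‖w₁ k‖ ^ 2 ≤ DeltaXir n 0 (shiftr n k s) ^ j₁)
    (h₂ : ∀ k, ‖w₂ k‖ ^ 2 ≤ DeltaXir n 0 (shiftr n k s) ^ j₂) :
    ‖sandwich w₁ w₂ (balabanFiber n hn a ha s hs hs0).G‖ ≤ gamma0 d a :=
  (balabanFiber n hn a ha s hs hs0).opNorm_sandwich_G_le_of_orders hj h₁ h₂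

/-- each fiber matrix is Hermitian ("G is a symmetric operator").
[cite: Balaban1984PropagatorsI, Prop. 1.1 p.33 ("G is a symmetric operator"; fiber form, proof ours)] -/
theorem G_isHermitian : (balabanFiber n hn a ha s hs hs0).G.IsHermitian :=
  (balabanFiber n hn a ha s hs hs0).G_isHermitian

/-! ### The six weighted fibers of (1.89) -/

/-- `∇_ν G` at the fiber: `‖D_{∂_ν} G(p′)‖ ≤ gamma0 d a`.
[cite: Balaban1984PropagatorsI, Prop. 1.1 (1.89) p.33 (fiber form; proof ours)] -/
theorem opNorm_D_G_le (ν : Fin d) :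
    ‖sandwich (fun k => dSym n k s ν) (fun _ => (1 : ℂ)) (balabanFiber n hn a ha s hs hs0).G‖
      ≤ gamma0 d a :=
  opNorm_sandwich_G_le_of_orders n hn a ha s hs hs0 (j₁ := 1) (j₂ := 0) (by norm_num)
    (weight_order_one n s ν) (weight_order_zero n s)

/-- `G ∇*_ν` at the fiber: `‖G(p′) D_{∂_ν}^*‖ ≤ gamma0 d a`.
[cite: Balaban1984PropagatorsI, Prop. 1.1 (1.89) p.33 (fiber form; proof ours)] -/
theorem opNorm_G_D_le (ν : Fin d) :
    ‖sandwich (fun _ => (1 : ℂ)) (fun k => dSym n k s ν) (balabanFiber n hn a ha s hs hs0).G‖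
      ≤ gamma0 d a :=
  opNorm_sandwich_G_le_of_orders n hn a ha s hs hs0 (j₁ := 0) (j₂ := 1) (by norm_num)
    (weight_order_zero n s) (weight_order_one n s ν)

/-- `∇_ν G ∇*_{ν′}` at the fiber: `‖D_{∂_ν} G(p′) D_{∂_{ν′}}^*‖ ≤ gamma0 d a`.
[cite: Balaban1984PropagatorsI, Prop. 1.1 (1.89) p.33 (fiber form; proof ours)] -/
theorem opNorm_D_G_D_le (ν ν' : Fin d) :
    ‖sandwich (fun k => dSym n k s ν) (fun k => dSym n k s ν') (balabanFiber n hn a ha s hs hs0).G‖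
      ≤ gamma0 d a :=
  opNorm_sandwich_G_le_of_orders n hn a ha s hs hs0 (j₁ := 1) (j₂ := 1) (by norm_num)
    (weight_order_one n s ν) (weight_order_one n s ν')

/-- `∇_ν ∇_{ν′} G` at the fiber: `‖D_{∂_ν ∂_{ν′}} G(p′)‖ ≤ gamma0 d a`.
[cite: Balaban1984PropagatorsI, Prop. 1.1 (1.89) p.33 (fiber form; proof ours)] -/
theorem opNorm_DD_G_le (ν ν' : Fin d) :
    ‖sandwich (fun k => dSym n k s ν * dSym n k s ν') (fun _ => (1 : ℂ))
      (balabanFiber n hn a ha s hs hs0).G‖ ≤ gamma0 d a :=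
  opNorm_sandwich_G_le_of_orders n hn a ha s hs hs0 (j₁ := 2) (j₂ := 0) (by norm_num)
    (weight_order_two n s ν ν') (weight_order_zero n s)

/-- `G ∇*_ν ∇*_{ν′}` at the fiber: `‖G(p′) D_{∂_ν ∂_{ν′}}^*‖ ≤ gamma0 d a`.
[cite: Balaban1984PropagatorsI, Prop. 1.1 (1.89) p.33 (fiber form; proof ours)] -/
theorem opNorm_G_DD_le (ν ν' : Fin d) :
    ‖sandwich (fun _ => (1 : ℂ)) (fun k => dSym n k s ν * dSym n k s ν')
      (balabanFiber n hn a ha s hs hs0).G‖ ≤ gamma0 d a :=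
  opNorm_sandwich_G_le_of_orders n hn a ha s hs hs0 (j₁ := 0) (j₂ := 2) (by norm_num)
    (weight_order_zero n s) (weight_order_two n s ν ν')

end Bounds

end

end Literature.MathematicalPhysics.QuantumFieldTheory.Balaban1983to89.B5Prop11Fiber
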